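import Literature.Combinatorics.Optimization.ShellLawMixedPinning
import Literature.Combinatorics.Optimization.ShellLawSmoothing
import Literature.Analysis.Calculus.ForwardDifferenceLeibniz
import HarnessLib

/-!
# Level differences of the quadratically weighted sections of the number of `HH` edges inside a cut:
# the exact Leibniz split (all orders) and the first level step as ONE second `x`-difference plus a drift

Continuation of `ShellLawFullEdgeMoments.lean` (pinning one / two full `HH` edges) and `ShellLawLevelStep.lean`
(`levelStep_shellLaw`: one step in the level is one second difference in the block statistic). Fix a fixed-point-free
involution `π` (a perfect matching), a `π`-stable ground set `S`, a block `H`; for a cut `U` write `X = |U ∩ H|` and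
`n_A(U) = #{v ∈ reps(vAA_π(S,H)) : v, πv ∈ U}` (the number of `HH` edges of `S` inside `U`). For real coefficients
`u₂, u₁, u₀` the QUADRATICALLY WEIGHTED SECTION of the shell `Shell_S(t,c)` at the point `x` is
`E_{S,t,c}[1_{X=x}·(u₂·n_A(n_A−1) + u₁·n_A + u₀)] = (Σ_{U ∈ Shell_S(t,c), |U∩H| = x} (u₂ n_A(n_A−1) + u₁ n_A + u₀)) / |Shell_S(t,c)|`
(the centred second moment `E[1_{X=x}(n_A − m)²]` of the cell's γ-direction criterion is `(u₂,u₁,u₀) = (1, 1−2m, m²)`,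
the centred first moment `E[1_{X=x}(n_A − m)]` is `(0, 1, −m)`, the law is `(0,0,1)`).

* §1 **`weightedSection_eq_laws`** (three-law form on ANY `π`-stable ground set): at cut `t₀+4`, level `c`,
  `E[1_x(u₂n_A(n_A−1) + u₁n_A + u₀)] = u₂·p₂(c)·Σ_{v≠w} law_{S∖e_v∖e_w}(t₀,c;x−4) + u₁·p₁(c)·Σ_v law_{S∖e_v}(t₀+2,c;x−2) + u₀·law_S(t₀+4,c;x)`,
  `p₁(c) = (t₀+4−c)/|S|`, `p₂(c) = (t₀+4−c)(t₀+2−c)/(|S|(|S|−2))` (sums over representatives of the `HH` edges).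
* §2 **`fwdDiff_iter_weightedSection_eq`** — THE LEIBNIZ SPLIT, every order `k`: since `p₂` is QUADRATIC and `p₁`
  LINEAR in the level, Boole's truncated Leibniz rule (`Literature.Analysis.fwdDiff_iter_smul_of_quadratic`) gives
  EXACTLY `Δ^k_j E_{c₀+2j}[…](0) = MAIN_k + k·DRIFT1_{k−1} + C(k,2)·DRIFT2_{k−2}` with FROZEN coefficients:
  `MAIN_k = u₂p₂(c₀)Δ^kG₂(0) + u₁p₁(c₀)Δ^kG₁(0) + u₀Δ^kG₀(0)`,
  `DRIFT1_{k−1} = u₂·Δp₂·Δ^{k−1}G₂(1) + u₁·Δp₁·Δ^{k−1}G₁(1)` (`Δp₁ = −2/|S|`, `Δp₂ = −4(t₀+2−c₀)/(|S|(|S|−2))`),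
  `DRIFT2_{k−2} = u₂·(8/(|S|(|S|−2)))·Δ^{k−2}G₂(2)`, where `G₂, G₁, G₀` are the three level profiles of laws of §1.
  No other drift exists at any order.
* §3 the regrouping `sum_reps_delStep_sdiff_pair_eq` of (one `HH` edge deleted) × (level-step pair deleted) as
  (pair deleted) × (`HH` edge of the remaining ground set deleted), and the FIRST LEVEL STEP (`k = 1`) made explicit:
  **`main_one_eq`** — `MAIN_1 = −(1/(|S|(|S|−2)))·Σ_{(p,q)} σ_{pq}·∇²_x E_{S_pq,t₀+4,c₀}[1_{X=·}(u₂′n_A(n_A−1) + u₁′n_A + u₀)](x)`,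
  ONE second `x`-difference of ONE quadratically weighted section on each two-edge-deleted ground set `S_pq` (`(p,q)` the
  level-step pairs of `ShellLawLevelStep`: `AA×DD` with `σ = +1`, `BH×(BN∖πp)` with `σ = −1`), with the tilted coefficients
  `u₂′ = u₂(t₀+6−c₀)/(t₀+2−c₀)`, `u₁′ = u₁(t₀+6−c₀)/(t₀+4−c₀)` (here the cut is `t₀+6`);
  **`drift_one_eq`** — `DRIFT1_0 = −(4u₂/(t₀+2−c₀))·E_{S,t₀+6,c₀+2}[1_x n_A(n_A−1)] − (2u₁/(t₀+4−c₀))·E_{S,t₀+6,c₀+2}[1_x n_A]`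
  (sections on `S` ITSELF at the next level); **`levelStep_centredSecond_eq`** — the two combined for the centred second
  moment `A^m`, with the drift written through `A^m, B^m = E[1_x(n_A−m)], law` at level `c₀+2`:
  `A^m_{c₀+2}(x) − A^m_{c₀}(x) = MAIN_1 − (4/(t₀+2−c₀))A^m_{c₀+2}(x) − (2m−1)(2(t₀+6−c₀)/((t₀+4−c₀)(t₀+2−c₀)))B^m_{c₀+2}(x)
   − (2m(4m+c₀−t₀−6)/((t₀+4−c₀)(t₀+2−c₀)))law_{c₀+2}(x)`.

All PROVED, 0 sorry, no definitions, no named facts: bookkeeping on Rothvoß's slack-matrix combinatorics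
[Rothvoß 2017, §2] plus Boole's Leibniz rule. Cell pnp-psdrank (prover g27; prover MEMO-29 §3b "(B1)" in the
Leibniz-first organisation of MEMO-30: the centred-basis criterion of the γ-direction needs the CANCELLING form only at
order `k = 1`; orders `k ≥ 2` are termwise). Exact brute-force checks of every identity: `n = 14, 16`, 0 failures.
Nothing here is about psd rank or P vs NP.

## References
* [Rothvoss2017] T. Rothvoß, *The matching polytope has exponential extension complexity*, J. ACM 64 (2017), §2
  (PDF pp. 5–6): cuts, perfect matchings, the three edge types, the level classes.
* [Boole2009] G. Boole, *A Treatise on the Calculus of Finite Differences* (1860; CUP 2009), Ch. II Art. 10 Ex. 3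
  eq. (8) (PDF pp. 34–35): the Leibniz rule for differences.
* [GodsilMeagher2015] C. Godsil, K. Meagher, *Erdős–Ko–Rado Theorems: Algebraic Approaches*, §15.2 (perfect matchings
  as fixed-point-free involutions; edge representatives).
-/

noncomputable section

open Finset

namespace Literature.Combinatorics.Optimization

namespace ShellStep

variable {n : ℕ} {π : Fin n → Fin n}

/-! ### §1 Quadratically weighted sections of `n_A`: the three-law form on any ground set -/

/-- Section sums are indicator sums: `Σ_{U ∈ Shell_S(t,c), |U∩H| = x} g(U) = Σ_{U ∈ Shell_S(t,c)} 1[|U∩H| = x]·g(U)`.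
[cite: Rothvoss2017, §2 (PDF p. 6)] -/
theorem sectionSum_eq_indicator (S H : Finset (Fin n)) (t c : ℕ) (x : ℤ) (g : Finset (Fin n) → ℝ)
    (ind : ℤ → ℝ) (hind : ∀ y, ind y = if y = x then 1 else 0) :
    ∑ U ∈ ((shellIn π S t c).filter fun U => ((U ∩ H).card : ℤ) = x), g U =
      ∑ U ∈ shellIn π S t c, ind ((U ∩ H).card : ℤ) * g U := by
  rw [sum_filter]
  refine sum_congr rfl fun U _ => ?_
  rw [hind]
  by_cases h : ((U ∩ H).card : ℤ) = x
  · simp only [h, if_true, one_mul]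
  · simp only [h, if_false, zero_mul]

/-- The average of a shifted indicator over a shell is the shell law at the shifted point:
`(Σ_{W ∈ Shell_S(t,c)} 1[|W∩H| + σ = x]) / |Shell_S(t,c)| = law_S(t,c; x − σ)`. [cite: Rothvoss2017, §2 (PDF p. 6)] -/
theorem shellAvg_shiftedIndicator_eq_shellLaw (S H : Finset (Fin n)) (t c : ℕ) (σ x : ℤ) (ind : ℤ → ℝ)
    (hind : ∀ y, ind y = if y = x then 1 else 0) :
    (∑ W ∈ shellIn π S t c, ind (((W ∩ H).card : ℤ) + σ)) / ((shellIn π S t c).card : ℝ) =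
      shellLaw π S H t c (x - σ) := by
  rw [shellLaw, shellCount]
  congr 1
  rw [card_filter]
  push_cast
  refine sum_congr rfl fun W _ => ?_
  rw [hind]
  by_cases h : ((W ∩ H).card : ℤ) + σ = x
  · rw [if_pos h, if_pos (by omega)]
  · rw [if_neg h, if_neg (by omega)]

section Pin

variable (hπ : ∀ v, π (π v) = v) (hπ' : ∀ v, π v ≠ v)
include hπ hπ'

/-- **The three-law form of a quadratically weighted section** (any `π`-stable ground set `S`, block `H`, cut `t₀+4`,
level `c` with `Shell_S(t₀+4,c) ≠ ∅`, coefficients `u₂,u₁,u₀`, point `x`):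
`E_{S,t₀+4,c}[1_{X=x}(u₂n_A(n_A−1) + u₁n_A + u₀)]
 = u₂·((t₀+4−c)(t₀+2−c)/(|S|(|S|−2)))·Σ_{v}Σ_{w≠v} law_{S∖e_v∖e_w}(t₀,c;x−4) + u₁·((t₀+4−c)/|S|)·Σ_v law_{S∖e_v}(t₀+2,c;x−2) + u₀·law_S(t₀+4,c;x)`
(`v, w` over the representatives of the `HH` edges of `S`; pinning one / two full edges, `ShellLawFullEdgeMoments` §4).
[cite: Rothvoss2017, §2 (PDF p. 6)] [cite: GodsilMeagher2015, §15.2] -/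
theorem weightedSection_eq_laws {S : Finset (Fin n)} (hS : ∀ u ∈ S, π u ∈ S) (H : Finset (Fin n))
    {t₀ c : ℕ} (hne : (shellIn π S (t₀ + 4) c).Nonempty) (u₂ u₁ u₀ : ℝ) (x : ℤ) :
    (∑ U ∈ ((shellIn π S (t₀ + 4) c).filter fun U => ((U ∩ H).card : ℤ) = x),
        (u₂ * (((((reps π (vAA π S H)).filter fun v => v ∈ U ∧ π v ∈ U).card : ℕ) : ℝ) *
            (((((reps π (vAA π S H)).filter fun v => v ∈ U ∧ π v ∈ U).card : ℕ) : ℝ) - 1)) +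
          u₁ * ((((reps π (vAA π S H)).filter fun v => v ∈ U ∧ π v ∈ U).card : ℕ) : ℝ) + u₀)) /
        ((shellIn π S (t₀ + 4) c).card : ℝ) =
      u₂ * ((((t₀ : ℝ) + 4 - c) * ((t₀ : ℝ) + 2 - c)) / ((S.card : ℝ) * ((S.card : ℝ) - 2))) *
          ∑ v ∈ reps π (vAA π S H), ∑ w ∈ (reps π (vAA π S H)).erase v,
            shellLaw π (del2 π S v w) H t₀ c (x - 4) +
        u₁ * (((t₀ : ℝ) + 4 - c) / (S.card : ℝ)) *
          ∑ v ∈ reps π (vAA π S H), shellLaw π (S \ {v, π v}) H (t₀ + 2) c (x - 2) +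
        u₀ * shellLaw π S H (t₀ + 4) c x := by
  obtain ⟨ind, hind⟩ : ∃ ind : ℤ → ℝ, ∀ y, ind y = if y = x then 1 else 0 :=
    ⟨fun y => if y = x then 1 else 0, fun _ => rfl⟩
  rw [sectionSum_eq_indicator S H (t₀ + 4) c x _ ind hind]
  have hsplit : ∑ U ∈ shellIn π S (t₀ + 4) c, ind ((U ∩ H).card : ℤ) *
      (u₂ * (((((reps π (vAA π S H)).filter fun v => v ∈ U ∧ π v ∈ U).card : ℕ) : ℝ) *
            (((((reps π (vAA π S H)).filter fun v => v ∈ U ∧ π v ∈ U).card : ℕ) : ℝ) - 1)) +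
          u₁ * ((((reps π (vAA π S H)).filter fun v => v ∈ U ∧ π v ∈ U).card : ℕ) : ℝ) + u₀) =
      u₂ * ∑ U ∈ shellIn π S (t₀ + 4) c, ind ((U ∩ H).card : ℤ) *
        (((((reps π (vAA π S H)).filter fun v => v ∈ U ∧ π v ∈ U).card : ℕ) : ℝ) *
          (((((reps π (vAA π S H)).filter fun v => v ∈ U ∧ π v ∈ U).card : ℕ) : ℝ) - 1)) +
      u₁ * ∑ U ∈ shellIn π S (t₀ + 4) c, ind ((U ∩ H).card : ℤ) *
        ((((reps π (vAA π S H)).filter fun v => v ∈ U ∧ π v ∈ U).card : ℕ) : ℝ) +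
      u₀ * ∑ U ∈ shellIn π S (t₀ + 4) c, ind (((U ∩ H).card : ℤ) + 0) := by
    rw [mul_sum, mul_sum, mul_sum, ← sum_add_distrib, ← sum_add_distrib]
    refine sum_congr rfl fun U _ => ?_
    simp only [add_zero]
    ring
  have ht₂ : t₀ + 2 + 2 = t₀ + 4 := by ring
  have h1 := shellAvg_mul_hhCount_eq hπ hπ' hS H (t₀ + 2) c ind (by rw [ht₂]; exact hne)
  rw [ht₂] at h1
  rw [hsplit, add_div, add_div, mul_div_assoc, mul_div_assoc, mul_div_assoc,
    shellAvg_mul_hhCount_mul_pred_eq hπ hπ' hS H t₀ c ind hne, h1,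
    shellAvg_shiftedIndicator_eq_shellLaw S H (t₀ + 4) c 0 x ind hind, sub_zero]
  have e1 : ∀ v ∈ reps π (vAA π S H), ∀ w ∈ (reps π (vAA π S H)).erase v,
      (∑ U'' ∈ shellIn π (del2 π S v w) t₀ c, ind (((U'' ∩ H).card : ℤ) + 4)) /
          ((shellIn π (del2 π S v w) t₀ c).card : ℝ) =
        shellLaw π (del2 π S v w) H t₀ c (x - 4) :=
    fun v _ w _ => shellAvg_shiftedIndicator_eq_shellLaw _ H t₀ c 4 x ind hind
  have e2 : ∀ v ∈ reps π (vAA π S H),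
      (∑ U' ∈ shellIn π (S \ {v, π v}) (t₀ + 2) c, ind (((U' ∩ H).card : ℤ) + 2)) /
          ((shellIn π (S \ {v, π v}) (t₀ + 2) c).card : ℝ) =
        shellLaw π (S \ {v, π v}) H (t₀ + 2) c (x - 2) :=
    fun v _ => shellAvg_shiftedIndicator_eq_shellLaw _ H (t₀ + 2) c 2 x ind hind
  rw [sum_congr rfl fun v hv => sum_congr rfl fun w hw => e1 v hv w hw, sum_congr rfl e2]
  push_cast
  ring

end Pin

/-! ### §2 The Leibniz split of the level differences of a weighted section (every order) -/

/-- Two functions that agree on `y, …, y+k` have the same `k`-th forward difference at `y`.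
[cite: Boole2009, Ch. II Art. 10 Ex. 3 eq. (8) (PDF pp. 34–35)] -/
theorem fwdDiff_iter_one_congr_of_le (k : ℕ) {f g : ℕ → ℝ} {y : ℕ}
    (h : ∀ i, i ≤ k → f (y + i) = g (y + i)) :
    (fwdDiff (1 : ℕ))^[k] f y = (fwdDiff (1 : ℕ))^[k] g y := by
  rw [fwdDiff_iter_eq_sum_shift, fwdDiff_iter_eq_sum_shift]
  refine sum_congr rfl fun i hi => ?_
  rw [smul_eq_mul, mul_one, h i (Nat.lt_succ_iff.1 (mem_range.1 hi))]

/-- The first difference, by definition. [cite: Boole2009, Ch. II Art. 10 Ex. 3 eq. (8) (PDF pp. 34–35)] -/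
theorem fwdDiff_one_apply (g : ℕ → ℝ) (y : ℕ) : fwdDiff (1 : ℕ) g y = g (y + 1) - g y := rfl

/-- The second difference spelled out. [cite: Boole2009, Ch. II Art. 10 Ex. 3 eq. (8) (PDF pp. 34–35)] -/
theorem fwdDiff_iter_two_apply (g : ℕ → ℝ) (y : ℕ) :
    (fwdDiff (1 : ℕ))^[2] g y = g (y + 2) - 2 * g (y + 1) + g y := by
  simp only [Function.iterate_succ, Function.iterate_zero, Function.comp_apply, id_eq, fwdDiff, add_assoc,
    Nat.reduceAdd]
  ring

/-- The third difference spelled out. [cite: Boole2009, Ch. II Art. 10 Ex. 3 eq. (8) (PDF pp. 34–35)] -/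
theorem fwdDiff_iter_three_apply (g : ℕ → ℝ) (y : ℕ) :
    (fwdDiff (1 : ℕ))^[3] g y = g (y + 3) - 3 * g (y + 2) + 3 * g (y + 1) - g y := by
  simp only [Function.iterate_succ, Function.iterate_zero, Function.comp_apply, id_eq, fwdDiff, add_assoc,
    Nat.reduceAdd]
  ring

/-- **The Leibniz split for a quadratic-times-profile plus linear-times-profile plus profile** (abstract form).
If `F(j) = u₂·((T−2j)(T−2−2j)/K)·G₂(j) + u₁·((T−2j)/K₁)·G₁(j) + u₀·G₀(j)` for `j ≤ k`, then
`Δ^kF(0) = u₂·(T(T−2)/K·Δ^kG₂(0) + k·(−4(T−2)/K)·Δ^{k−1}G₂(1) + C(k,2)·(8/K)·Δ^{k−2}G₂(2))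
 + u₁·(T/K₁·Δ^kG₁(0) + k·(−2/K₁)·Δ^{k−1}G₁(1)) + u₀·Δ^kG₀(0)`
(Boole's truncated Leibniz rule for a quadratic, resp. linear, prefactor; the coefficients are frozen at `j = 0`).
[cite: Boole2009, Ch. II Art. 10 Ex. 3 eq. (8) (PDF pp. 34–35)] -/
theorem fwdDiff_iter_threeLaw_eq (F G₂ G₁ G₀ : ℕ → ℝ) (T K K₁ u₂ u₁ u₀ : ℝ) (k : ℕ)
    (hF : ∀ j, j ≤ k → F j =
      u₂ * (((T - 2 * (j : ℝ)) * (T - 2 - 2 * (j : ℝ))) / K) * G₂ j + u₁ * ((T - 2 * (j : ℝ)) / K₁) * G₁ j +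
        u₀ * G₀ j) :
    (fwdDiff (1 : ℕ))^[k] F 0 =
      u₂ * ((T * (T - 2)) / K * (fwdDiff (1 : ℕ))^[k] G₂ 0 +
            (k : ℝ) * (-(4 * (T - 2)) / K) * (fwdDiff (1 : ℕ))^[k - 1] G₂ 1 +
            ((k.choose 2 : ℕ) : ℝ) * (8 / K) * (fwdDiff (1 : ℕ))^[k - 2] G₂ 2) +
        u₁ * (T / K₁ * (fwdDiff (1 : ℕ))^[k] G₁ 0 + (k : ℝ) * (-2 / K₁) * (fwdDiff (1 : ℕ))^[k - 1] G₁ 1) +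
        u₀ * (fwdDiff (1 : ℕ))^[k] G₀ 0 := by
  obtain ⟨f₂, hf₂⟩ : ∃ f : ℕ → ℝ, ∀ j, f j = ((T - 2 * (j : ℝ)) * (T - 2 - 2 * (j : ℝ))) / K :=
    ⟨fun j => ((T - 2 * (j : ℝ)) * (T - 2 - 2 * (j : ℝ))) / K, fun _ => rfl⟩
  obtain ⟨f₁, hf₁⟩ : ∃ f : ℕ → ℝ, ∀ j, f j = (T - 2 * (j : ℝ)) / K₁ := ⟨fun j => (T - 2 * (j : ℝ)) / K₁, fun _ => rfl⟩
  -- the profile as a sum of three (scalar function) × (profile) terms on `[0, k]`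
  have hagree : ∀ i, i ≤ k → F (0 + i) = (f₂ * (u₂ • G₂) + (f₁ * (u₁ • G₁) + u₀ • G₀)) (0 + i) := by
    intro i hi
    rw [zero_add, hF i hi]
    simp only [Pi.add_apply, Pi.mul_apply, Pi.smul_apply, smul_eq_mul, hf₂, hf₁]
    ring
  rw [fwdDiff_iter_one_congr_of_le k hagree, fwdDiff_iter_add, fwdDiff_iter_add, Pi.add_apply, Pi.add_apply]
  -- the two prefactors are polynomials of degree ≤ 2 in `j`
  have hf₂3 : (fwdDiff (1 : ℕ))^[3] f₂ = 0 := by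
    funext y
    rw [fwdDiff_iter_three_apply, Pi.zero_apply, hf₂, hf₂, hf₂, hf₂]
    push_cast
    ring
  have hf₁3 : (fwdDiff (1 : ℕ))^[3] f₁ = 0 := by
    funext y
    rw [fwdDiff_iter_three_apply, Pi.zero_apply, hf₁, hf₁, hf₁, hf₁]
    push_cast
    ring
  -- Boole's truncated Leibniz rule (the `•` of two real functions there is their product)
  have L2 : (fwdDiff (1 : ℕ))^[k] (f₂ * (u₂ • G₂)) 0 =
      f₂ 0 • (fwdDiff (1 : ℕ))^[k] (u₂ • G₂) 0 +
        k • (fwdDiff (1 : ℕ) f₂ 0 • (fwdDiff (1 : ℕ))^[k - 1] (u₂ • G₂) (0 + 1)) +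
        k.choose 2 • ((fwdDiff (1 : ℕ))^[2] f₂ 0 • (fwdDiff (1 : ℕ))^[k - 2] (u₂ • G₂) (0 + 2 • (1 : ℕ))) :=
    Literature.Analysis.fwdDiff_iter_smul_of_quadratic (1 : ℕ) f₂ (u₂ • G₂) hf₂3 k 0
  have L1 : (fwdDiff (1 : ℕ))^[k] (f₁ * (u₁ • G₁)) 0 =
      f₁ 0 • (fwdDiff (1 : ℕ))^[k] (u₁ • G₁) 0 +
        k • (fwdDiff (1 : ℕ) f₁ 0 • (fwdDiff (1 : ℕ))^[k - 1] (u₁ • G₁) (0 + 1)) +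
        k.choose 2 • ((fwdDiff (1 : ℕ))^[2] f₁ 0 • (fwdDiff (1 : ℕ))^[k - 2] (u₁ • G₁) (0 + 2 • (1 : ℕ))) :=
    Literature.Analysis.fwdDiff_iter_smul_of_quadratic (1 : ℕ) f₁ (u₁ • G₁) hf₁3 k 0
  rw [L2, L1]
  simp only [fwdDiff_iter_const_smul, Pi.smul_apply, smul_eq_mul, nsmul_eq_mul, zero_add, mul_one,
    fwdDiff_one_apply, fwdDiff_iter_two_apply, hf₂, hf₁]
  push_cast
  ring

section Split

variable (hπ : ∀ v, π (π v) = v) (hπ' : ∀ v, π v ≠ v)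
include hπ hπ'

/-- **THE LEIBNIZ SPLIT of the level differences of a quadratically weighted section** (any order `k`). For a
`π`-stable `S`, a block `H`, a cut `t₀+4`, a base level `c₀` with `Shell_S(t₀+4, c₀+2k) ≠ ∅`, coefficients `u₂,u₁,u₀`
and a point `x`, the `k`-th forward difference at `j = 0` of the level profile `j ↦ E_{S,t₀+4,c₀+2j}[1_{X=x}(u₂n_A(n_A−1)+u₁n_A+u₀)]`
equals, with `K = |S|(|S|−2)`, `T = t₀+4−c₀` and the three law profiles
`G₂(j) = Σ_{v≠w} law_{S∖e_v∖e_w}(t₀,c₀+2j;x−4)`, `G₁(j) = Σ_v law_{S∖e_v}(t₀+2,c₀+2j;x−2)`, `G₀(j) = law_S(t₀+4,c₀+2j;x)`: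
`u₂·(T(T−2)/K·Δ^kG₂(0) − k·(4(T−2)/K)·Δ^{k−1}G₂(1) + C(k,2)·(8/K)·Δ^{k−2}G₂(2)) + u₁·(T/|S|·Δ^kG₁(0) − k·(2/|S|)·Δ^{k−1}G₁(1)) + u₀·Δ^kG₀(0)`
— MAIN (frozen pinning probabilities) + `k`·DRIFT1 + `C(k,2)`·DRIFT2, and nothing else at any order.
[cite: Rothvoss2017, §2 (PDF p. 6)] [cite: Boole2009, Ch. II Art. 10 Ex. 3 eq. (8) (PDF pp. 34–35)] -/
theorem fwdDiff_iter_weightedSection_eq {S : Finset (Fin n)} (hS : ∀ u ∈ S, π u ∈ S) (H : Finset (Fin n))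
    {t₀ c₀ : ℕ} (k : ℕ) (hne : (shellIn π S (t₀ + 4) (c₀ + 2 * k)).Nonempty) (u₂ u₁ u₀ : ℝ) (x : ℤ) :
    (fwdDiff (1 : ℕ))^[k] (fun j : ℕ =>
        (∑ U ∈ ((shellIn π S (t₀ + 4) (c₀ + 2 * j)).filter fun U => ((U ∩ H).card : ℤ) = x),
          (u₂ * (((((reps π (vAA π S H)).filter fun v => v ∈ U ∧ π v ∈ U).card : ℕ) : ℝ) *
              (((((reps π (vAA π S H)).filter fun v => v ∈ U ∧ π v ∈ U).card : ℕ) : ℝ) - 1)) +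
            u₁ * ((((reps π (vAA π S H)).filter fun v => v ∈ U ∧ π v ∈ U).card : ℕ) : ℝ) + u₀)) /
          ((shellIn π S (t₀ + 4) (c₀ + 2 * j)).card : ℝ)) 0 =
      u₂ * ((((t₀ : ℝ) + 4 - c₀) * ((t₀ : ℝ) + 4 - c₀ - 2)) / ((S.card : ℝ) * ((S.card : ℝ) - 2)) *
              (fwdDiff (1 : ℕ))^[k] (fun j : ℕ => ∑ v ∈ reps π (vAA π S H), ∑ w ∈ (reps π (vAA π S H)).erase v,
                shellLaw π (del2 π S v w) H t₀ (c₀ + 2 * j) (x - 4)) 0 +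
            (k : ℝ) * (-(4 * ((t₀ : ℝ) + 4 - c₀ - 2)) / ((S.card : ℝ) * ((S.card : ℝ) - 2))) *
              (fwdDiff (1 : ℕ))^[k - 1] (fun j : ℕ => ∑ v ∈ reps π (vAA π S H), ∑ w ∈ (reps π (vAA π S H)).erase v,
                shellLaw π (del2 π S v w) H t₀ (c₀ + 2 * j) (x - 4)) 1 +
            ((k.choose 2 : ℕ) : ℝ) * (8 / ((S.card : ℝ) * ((S.card : ℝ) - 2))) *
              (fwdDiff (1 : ℕ))^[k - 2] (fun j : ℕ => ∑ v ∈ reps π (vAA π S H), ∑ w ∈ (reps π (vAA π S H)).erase v,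
                shellLaw π (del2 π S v w) H t₀ (c₀ + 2 * j) (x - 4)) 2) +
        u₁ * (((t₀ : ℝ) + 4 - c₀) / (S.card : ℝ) *
              (fwdDiff (1 : ℕ))^[k] (fun j : ℕ => ∑ v ∈ reps π (vAA π S H),
                shellLaw π (S \ {v, π v}) H (t₀ + 2) (c₀ + 2 * j) (x - 2)) 0 +
            (k : ℝ) * (-2 / (S.card : ℝ)) *
              (fwdDiff (1 : ℕ))^[k - 1] (fun j : ℕ => ∑ v ∈ reps π (vAA π S H),
                shellLaw π (S \ {v, π v}) H (t₀ + 2) (c₀ + 2 * j) (x - 2)) 1) +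
        u₀ * (fwdDiff (1 : ℕ))^[k] (fun j : ℕ => shellLaw π S H (t₀ + 4) (c₀ + 2 * j) x) 0 := by
  refine fwdDiff_iter_threeLaw_eq _ _ _ _ ((t₀ : ℝ) + 4 - c₀) ((S.card : ℝ) * ((S.card : ℝ) - 2)) (S.card : ℝ)
    u₂ u₁ u₀ k fun j hj => ?_
  have hnej : (shellIn π S (t₀ + 4) (c₀ + 2 * j)).Nonempty := by
    refine shellIn_nonempty_of_le hπ hπ' hS (k - j) ?_
    rw [show c₀ + 2 * j + 2 * (k - j) = c₀ + 2 * k by omega]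
    exact hne
  rw [weightedSection_eq_laws hπ hπ' hS H hnej u₂ u₁ u₀ x]
  push_cast
  ring

end Split

/-! ### §3 The first level step: the regrouping, MAIN_1 as ONE second `x`-difference, and the drift -/

section StepOne

variable (hπ : ∀ v, π (π v) = v) (hπ' : ∀ v, π v ≠ v)
include hπ hπ'

omit hπ hπ' in
/-- Deleting an `HH` edge: the remaining `HH` vertices. [cite: Rothvoss2017, §2 (PDF p. 5)] -/
theorem vAA_sdiff_pair (S H : Finset (Fin n)) (v : Fin n) :
    vAA π (S \ {v, π v}) H = (vAA π S H).filter fun p => p ≠ v ∧ p ≠ π v := by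
  ext p
  simp only [mem_vAA, mem_sdiff, mem_insert, mem_singleton, not_or, mem_filter]
  tauto

omit hπ hπ' in
/-- Deleting an `HH` edge does not touch the `H̄H̄` vertices. [cite: Rothvoss2017, §2 (PDF p. 5)] -/
theorem vDD_sdiff_pair_of_mem_vAA {S H : Finset (Fin n)} {v : Fin n} (hv : v ∈ vAA π S H) :
    vDD π (S \ {v, π v}) H = vDD π S H := by
  obtain ⟨-, hvH, hπvH⟩ := mem_vAA.1 hv
  ext p
  simp only [mem_vDD, mem_sdiff, mem_insert, mem_singleton, not_or]
  constructor
  · rintro ⟨⟨hpS, -, -⟩, hpH, hπpH⟩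
    exact ⟨hpS, hpH, hπpH⟩
  · rintro ⟨hpS, hpH, hπpH⟩
    refine ⟨⟨hpS, ?_, ?_⟩, hpH, hπpH⟩
    · rintro rfl; exact hpH hvH
    · rintro rfl; exact hpH hπvH

omit hπ' in
/-- Deleting an `HH` edge does not touch the `H`-endpoints of the mixed edges. [cite: Rothvoss2017, §2 (PDF p. 5)] -/
theorem vBH_sdiff_pair_of_mem_vAA {S H : Finset (Fin n)} {v : Fin n} (hv : v ∈ vAA π S H) :
    vBH π (S \ {v, π v}) H = vBH π S H := by
  obtain ⟨-, hvH, hπvH⟩ := mem_vAA.1 hv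
  ext p
  simp only [mem_vBH, mem_sdiff, mem_insert, mem_singleton, not_or]
  constructor
  · rintro ⟨⟨hpS, -, -⟩, hpH, hπpH⟩
    exact ⟨hpS, hpH, hπpH⟩
  · rintro ⟨hpS, hpH, hπpH⟩
    refine ⟨⟨hpS, ?_, ?_⟩, hpH, hπpH⟩
    · rintro rfl; exact hπpH hπvH
    · rintro rfl; rw [hπ] at hπpH; exact hπpH hvH

omit hπ hπ' in
/-- Deleting an `HH` edge does not touch the non-`H` endpoints of the mixed edges. [cite: Rothvoss2017, §2 (PDF p. 5)] -/
theorem vBN_sdiff_pair_of_mem_vAA {S H : Finset (Fin n)} {v : Fin n} (hv : v ∈ vAA π S H) :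
    vBN π (S \ {v, π v}) H = vBN π S H := by
  obtain ⟨-, hvH, hπvH⟩ := mem_vAA.1 hv
  ext p
  simp only [mem_vBN, mem_sdiff, mem_insert, mem_singleton, not_or]
  constructor
  · rintro ⟨⟨hpS, -, -⟩, hpH, hπpH⟩
    exact ⟨hpS, hpH, hπpH⟩
  · rintro ⟨hpS, hpH, hπpH⟩
    refine ⟨⟨hpS, ?_, ?_⟩, hpH, hπpH⟩
    · rintro rfl; exact hpH hvH
    · rintro rfl; exact hpH hπvH

omit hπ hπ' in
/-- After deleting an `HH×H̄H̄` pair, the representatives of the `HH` edges are those off the deleted `HH` edge.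
[cite: GodsilMeagher2015, §15.2] -/
theorem reps_vAA_del2_of_AD {S H : Finset (Fin n)} {p q : Fin n} (hq : q ∈ vDD π S H) :
    reps π (vAA π (del2 π S p q) H) = (reps π (vAA π S H)).filter fun v => v ≠ p ∧ v ≠ π p := by
  obtain ⟨-, hqH, hπqH⟩ := mem_vDD.1 hq
  ext v
  simp only [mem_reps, mem_vAA, mem_del2, mem_filter]
  constructor
  · rintro ⟨⟨⟨hvS, hvp, hvπp, -, -⟩, hvH, hπvH⟩, hlt⟩
    exact ⟨⟨⟨hvS, hvH, hπvH⟩, hlt⟩, hvp, hvπp⟩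
  · rintro ⟨⟨⟨hvS, hvH, hπvH⟩, hlt⟩, hvp, hvπp⟩
    refine ⟨⟨⟨hvS, hvp, hvπp, ?_, ?_⟩, hvH, hπvH⟩, hlt⟩
    · rintro rfl; exact hqH hvH
    · rintro rfl; exact hπqH hvH

omit hπ' in
/-- After deleting two mixed edges, the representatives of the `HH` edges are unchanged. [cite: GodsilMeagher2015, §15.2] -/
theorem reps_vAA_del2_of_BB {S H : Finset (Fin n)} {p q : Fin n} (hp : p ∈ vBH π S H) (hq : q ∈ vBN π S H) :
    reps π (vAA π (del2 π S p q) H) = reps π (vAA π S H) := by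
  obtain ⟨-, hpH, hπpH⟩ := mem_vBH.1 hp
  obtain ⟨-, hqH, hπqH⟩ := mem_vBN.1 hq
  ext v
  simp only [mem_reps, mem_vAA, mem_del2]
  constructor
  · rintro ⟨⟨⟨hvS, -, -, -, -⟩, hvH, hπvH⟩, hlt⟩
    exact ⟨⟨hvS, hvH, hπvH⟩, hlt⟩
  · rintro ⟨⟨hvS, hvH, hπvH⟩, hlt⟩
    refine ⟨⟨⟨hvS, ?_, ?_, ?_, ?_⟩, hvH, hπvH⟩, hlt⟩
    · rintro rfl; exact hπpH hπvH
    · rintro rfl; rw [hπ] at hπvH; exact hπpH hvH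
    · rintro rfl; exact hqH hvH
    · rintro rfl; rw [hπ] at hπvH; exact hqH hπvH

omit hπ' in
/-- The representatives of the `HH` edges of `S ∖ e_v`, `v` a representative: all the others.
[cite: GodsilMeagher2015, §15.2] -/
theorem reps_vAA_sdiff_pair {S H : Finset (Fin n)} {v : Fin n} (hv : v ∈ reps π (vAA π S H)) :
    reps π (vAA π (S \ {v, π v}) H) = (reps π (vAA π S H)).erase v := by
  have hvlt := (mem_reps.1 hv).2
  ext w
  simp only [mem_reps, vAA_sdiff_pair, mem_filter, mem_erase]
  constructor
  · rintro ⟨⟨hw, hwv, -⟩, hlt⟩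
    exact ⟨hwv, hw, hlt⟩
  · rintro ⟨hwv, hw, hlt⟩
    refine ⟨⟨hw, hwv, ?_⟩, hlt⟩
    rintro rfl
    rw [hπ] at hlt
    exact lt_asymm hvlt hlt

omit hπ hπ' in
/-- Edge deletions commute: `(S ∖ e_v) ∖ e_p ∖ e_q = (S ∖ e_p ∖ e_q) ∖ e_v`. [cite: GodsilMeagher2015, §15.2] -/
theorem del2_sdiff_pair (S : Finset (Fin n)) (v p q : Fin n) :
    del2 π (S \ {v, π v}) p q = del2 π S p q \ {v, π v} := by
  ext u
  simp only [mem_del2, mem_sdiff, mem_insert, mem_singleton, not_or]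
  tauto

omit hπ hπ' in
/-- **The regrouping.** Deleting an `HH` edge `e_v` and then a level-step pair of `S ∖ e_v` (an `HH×H̄H̄` pair with sign
`+`, two distinct mixed edges with sign `−`) is the same as deleting a level-step pair of `S` and then an `HH` edge of what
remains: for every function `Φ` of the ground set,
`Σ_{v ∈ reps(vAA S)} [Σ_{AD pairs of S∖e_v} Φ(S∖e_v∖e_p∖e_q) − Σ_{BB pairs of S∖e_v} Φ(…)]
 = Σ_{AD pairs of S} Σ_{v ∈ reps(vAA(S∖e_p∖e_q))} Φ(S∖e_p∖e_q∖e_v) − Σ_{BB pairs of S} Σ_{v ∈ reps(vAA(S∖e_p∖e_q))} Φ(…)`.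
[cite: Rothvoss2017, §2 (PDF p. 6)] [cite: GodsilMeagher2015, §15.2] -/
theorem sum_reps_delStep_sdiff_pair_eq (hπ : ∀ v, π (π v) = v) (S H : Finset (Fin n)) (Φ : Finset (Fin n) → ℝ) :
    ∑ v ∈ reps π (vAA π S H),
        ((∑ p ∈ vAA π (S \ {v, π v}) H, ∑ q ∈ vDD π (S \ {v, π v}) H, Φ (del2 π (S \ {v, π v}) p q)) -
          ∑ p ∈ vBH π (S \ {v, π v}) H, ∑ q ∈ (vBN π (S \ {v, π v}) H).erase (π p),
            Φ (del2 π (S \ {v, π v}) p q)) =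
      (∑ p ∈ vAA π S H, ∑ q ∈ vDD π S H, ∑ v ∈ reps π (vAA π (del2 π S p q) H),
          Φ (del2 π S p q \ {v, π v})) -
        ∑ p ∈ vBH π S H, ∑ q ∈ (vBN π S H).erase (π p), ∑ v ∈ reps π (vAA π (del2 π S p q) H),
          Φ (del2 π S p q \ {v, π v}) := by
  have hvA : ∀ v ∈ reps π (vAA π S H), v ∈ vAA π S H := fun v hv => (mem_reps.1 hv).1
  rw [sum_sub_distrib]
  refine congrArg₂ (fun a b : ℝ => a - b) ?_ ?_
  · -- the `AD` part
    calc ∑ v ∈ reps π (vAA π S H), ∑ p ∈ vAA π (S \ {v, π v}) H, ∑ q ∈ vDD π (S \ {v, π v}) H,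
            Φ (del2 π (S \ {v, π v}) p q)
        = ∑ v ∈ reps π (vAA π S H), ∑ p ∈ (vAA π S H).filter (fun p => p ≠ v ∧ p ≠ π v),
            ∑ q ∈ vDD π S H, Φ (del2 π S p q \ {v, π v}) := by
          refine sum_congr rfl fun v hv => ?_
          rw [vAA_sdiff_pair, vDD_sdiff_pair_of_mem_vAA (hvA v hv)]
          exact sum_congr rfl fun p _ => sum_congr rfl fun q _ => by rw [del2_sdiff_pair]
      _ = ∑ p ∈ vAA π S H, ∑ v ∈ (reps π (vAA π S H)).filter (fun v => v ≠ p ∧ v ≠ π p),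
            ∑ q ∈ vDD π S H, Φ (del2 π S p q \ {v, π v}) := by
          refine sum_comm' fun v p => ?_
          simp only [mem_filter]
          constructor
          · rintro ⟨hv, hp, hpv, hpπv⟩
            exact ⟨⟨hv, fun e => hpv e.symm, fun e => hpπv (by rw [e, hπ])⟩, hp⟩
          · rintro ⟨⟨hv, hvp, hvπp⟩, hp⟩
            exact ⟨hv, hp, fun e => hvp e.symm, fun e => hvπp (by rw [e, hπ])⟩
      _ = _ := by
          refine sum_congr rfl fun p _ => ?_
          rw [sum_comm]
          refine sum_congr rfl fun q hq => ?_
          rw [reps_vAA_del2_of_AD hq]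
  · -- the `BB` part
    calc ∑ v ∈ reps π (vAA π S H), ∑ p ∈ vBH π (S \ {v, π v}) H, ∑ q ∈ (vBN π (S \ {v, π v}) H).erase (π p),
            Φ (del2 π (S \ {v, π v}) p q)
        = ∑ v ∈ reps π (vAA π S H), ∑ p ∈ vBH π S H, ∑ q ∈ (vBN π S H).erase (π p),
            Φ (del2 π S p q \ {v, π v}) := by
          refine sum_congr rfl fun v hv => ?_
          rw [vBH_sdiff_pair_of_mem_vAA hπ (hvA v hv), vBN_sdiff_pair_of_mem_vAA (hvA v hv)]
          exact sum_congr rfl fun p _ => sum_congr rfl fun q _ => by rw [del2_sdiff_pair]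
      _ = ∑ p ∈ vBH π S H, ∑ v ∈ reps π (vAA π S H), ∑ q ∈ (vBN π S H).erase (π p),
            Φ (del2 π S p q \ {v, π v}) := sum_comm
      _ = _ := by
          refine sum_congr rfl fun p hp => ?_
          rw [sum_comm]
          refine sum_congr rfl fun q hq => ?_
          rw [reps_vAA_del2_of_BB hπ hp (mem_erase.1 hq).2]

omit hπ' in
/-- The regrouping applied to the signed deletion sums of laws: `Σ_{v ∈ reps(vAA S)} delStepLaw_{S∖e_v}(T,c;y)
= Σ_{AD pairs} Σ_{v ∈ reps(vAA S_pq)} law_{S_pq∖e_v}(T,c;y) − Σ_{BB pairs} Σ_{v ∈ reps(vAA S_pq)} law_{S_pq∖e_v}(T,c;y)`.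
[cite: Rothvoss2017, §2 (PDF p. 6)] -/
theorem sum_reps_delStepLaw_sdiff_pair_eq (S H : Finset (Fin n)) (T c : ℕ) (y : ℤ) :
    ∑ v ∈ reps π (vAA π S H), delStepLaw π (S \ {v, π v}) H T c y =
      (∑ p ∈ vAA π S H, ∑ q ∈ vDD π S H, ∑ v ∈ reps π (vAA π (del2 π S p q) H),
          shellLaw π (del2 π S p q \ {v, π v}) H T c y) -
        ∑ p ∈ vBH π S H, ∑ q ∈ (vBN π S H).erase (π p), ∑ v ∈ reps π (vAA π (del2 π S p q) H),
          shellLaw π (del2 π S p q \ {v, π v}) H T c y := by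
  have h := sum_reps_delStep_sdiff_pair_eq hπ S H fun G => shellLaw π G H T c y
  unfold delStepLaw
  exact h

omit hπ' in
/-- The regrouping applied twice: `Σ_{v} Σ_{w ≠ v} delStepLaw_{S∖e_v∖e_w}(T,c;y)
= Σ_{AD pairs} Σ_{v}Σ_{w≠v ∈ reps(vAA S_pq)} law_{S_pq∖e_v∖e_w}(T,c;y) − Σ_{BB pairs} (same)`.
[cite: Rothvoss2017, §2 (PDF p. 6)] -/
theorem sum_reps_reps_delStepLaw_del2_eq (S H : Finset (Fin n)) (T c : ℕ) (y : ℤ) :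
    ∑ v ∈ reps π (vAA π S H), ∑ w ∈ (reps π (vAA π S H)).erase v, delStepLaw π (del2 π S v w) H T c y =
      (∑ p ∈ vAA π S H, ∑ q ∈ vDD π S H, ∑ v ∈ reps π (vAA π (del2 π S p q) H),
          ∑ w ∈ (reps π (vAA π (del2 π S p q) H)).erase v, shellLaw π (del2 π (del2 π S p q) v w) H T c y) -
        ∑ p ∈ vBH π S H, ∑ q ∈ (vBN π S H).erase (π p), ∑ v ∈ reps π (vAA π (del2 π S p q) H),
          ∑ w ∈ (reps π (vAA π (del2 π S p q) H)).erase v, shellLaw π (del2 π (del2 π S p q) v w) H T c y := by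
  -- inner regrouping on `S ∖ e_v`, then the outer one on `S` with `Φ(G) = Σ_{w ∈ reps(vAA G)} law_{G∖e_w}`
  have hinner : ∀ v ∈ reps π (vAA π S H),
      ∑ w ∈ (reps π (vAA π S H)).erase v, delStepLaw π (del2 π S v w) H T c y =
        (∑ p ∈ vAA π (S \ {v, π v}) H, ∑ q ∈ vDD π (S \ {v, π v}) H,
            ∑ w ∈ reps π (vAA π (del2 π (S \ {v, π v}) p q) H),
              shellLaw π (del2 π (S \ {v, π v}) p q \ {w, π w}) H T c y) -
          ∑ p ∈ vBH π (S \ {v, π v}) H, ∑ q ∈ (vBN π (S \ {v, π v}) H).erase (π p),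
            ∑ w ∈ reps π (vAA π (del2 π (S \ {v, π v}) p q) H),
              shellLaw π (del2 π (S \ {v, π v}) p q \ {w, π w}) H T c y := by
    intro v hv
    rw [← reps_vAA_sdiff_pair hπ hv, ← sum_reps_delStepLaw_sdiff_pair_eq hπ (S \ {v, π v}) H T c y]
    exact sum_congr rfl fun w _ => by rw [del2_eq_sdiff_sdiff]
  have houter := sum_reps_delStep_sdiff_pair_eq hπ S H
    (fun G => ∑ w ∈ reps π (vAA π G H), shellLaw π (G \ {w, π w}) H T c y)
  rw [sum_congr rfl hinner, houter]
  refine congrArg₂ (fun a b : ℝ => a - b) ?_ ?_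
  · refine sum_congr rfl fun p _ => sum_congr rfl fun q _ => sum_congr rfl fun v hv => ?_
    rw [reps_vAA_sdiff_pair hπ hv]
    exact sum_congr rfl fun w _ => by rw [del2_eq_sdiff_sdiff (del2 π S p q) v w]
  · refine sum_congr rfl fun p _ => sum_congr rfl fun q _ => sum_congr rfl fun v hv => ?_
    rw [reps_vAA_sdiff_pair hπ hv]
    exact sum_congr rfl fun w _ => by rw [del2_eq_sdiff_sdiff (del2 π S p q) v w]

omit hπ hπ' in
/-- Linearity bookkeeping for a signed double sum of three-term combinations. [cite: Rothvoss2017, §2 (PDF p. 6)] -/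
theorem signedPairSum_three {ι : Type*} (sA : Finset ι) (tA : ι → Finset ι) (sB : Finset ι) (tB : ι → Finset ι)
    (α β γ : ℝ) (A B C : ι → ι → ℝ) :
    (∑ p ∈ sA, ∑ q ∈ tA p, (α * A p q + β * B p q + γ * C p q)) -
        ∑ p ∈ sB, ∑ q ∈ tB p, (α * A p q + β * B p q + γ * C p q) =
      α * ((∑ p ∈ sA, ∑ q ∈ tA p, A p q) - ∑ p ∈ sB, ∑ q ∈ tB p, A p q) +
        β * ((∑ p ∈ sA, ∑ q ∈ tA p, B p q) - ∑ p ∈ sB, ∑ q ∈ tB p, B p q) +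
        γ * ((∑ p ∈ sA, ∑ q ∈ tA p, C p q) - ∑ p ∈ sB, ∑ q ∈ tB p, C p q) := by
  simp only [sum_add_distrib, mul_sum, mul_sub]
  ring

omit hπ hπ' in
/-- Linearity bookkeeping for the second `x`-difference under a signed double sum. [cite: Rothvoss2017, §2 (PDF p. 6)] -/
theorem signedPairSum_nab2 {ι : Type*} (sA : Finset ι) (tA : ι → Finset ι) (sB : Finset ι) (tB : ι → Finset ι)
    (F : ι → ι → ℤ → ℝ) (x : ℤ) :
    (∑ p ∈ sA, ∑ q ∈ tA p, (F p q x - 2 * F p q (x - 1) + F p q (x - 2))) -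
        ∑ p ∈ sB, ∑ q ∈ tB p, (F p q x - 2 * F p q (x - 1) + F p q (x - 2)) =
      ((∑ p ∈ sA, ∑ q ∈ tA p, F p q x) - ∑ p ∈ sB, ∑ q ∈ tB p, F p q x) -
        2 * ((∑ p ∈ sA, ∑ q ∈ tA p, F p q (x - 1)) - ∑ p ∈ sB, ∑ q ∈ tB p, F p q (x - 1)) +
        ((∑ p ∈ sA, ∑ q ∈ tA p, F p q (x - 2)) - ∑ p ∈ sB, ∑ q ∈ tB p, F p q (x - 2)) := by
  simp only [sum_add_distrib, sum_sub_distrib, mul_sum, mul_sub]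
  ring

omit hπ hπ' in
/-- Linearity bookkeeping for a double sum of scaled second differences. [cite: Rothvoss2017, §2 (PDF p. 6)] -/
theorem sum_sum_mul_nab2 {ι : Type*} (s : Finset ι) (t : ι → Finset ι) (κ : ℝ) (D : ι → ι → ℤ → ℝ) (y : ℤ) :
    ∑ v ∈ s, ∑ w ∈ t v, κ * (D v w y - 2 * D v w (y - 1) + D v w (y - 2)) =
      κ * ((∑ v ∈ s, ∑ w ∈ t v, D v w y) - 2 * ∑ v ∈ s, ∑ w ∈ t v, D v w (y - 1) +
        ∑ v ∈ s, ∑ w ∈ t v, D v w (y - 2)) := by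
  simp only [sum_add_distrib, sum_sub_distrib, mul_sum, mul_add, mul_sub]

omit hπ hπ' in
/-- Linearity bookkeeping for a sum of scaled second differences. [cite: Rothvoss2017, §2 (PDF p. 6)] -/
theorem sum_mul_nab2 {ι : Type*} (s : Finset ι) (κ : ℝ) (D : ι → ℤ → ℝ) (y : ℤ) :
    ∑ v ∈ s, κ * (D v y - 2 * D v (y - 1) + D v (y - 2)) =
      κ * ((∑ v ∈ s, D v y) - 2 * ∑ v ∈ s, D v (y - 1) + ∑ v ∈ s, D v (y - 2)) := by
  simp only [sum_add_distrib, sum_sub_distrib, mul_sum, mul_add, mul_sub]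

/-- **MAIN₁ IS ONE SECOND `x`-DIFFERENCE OF ONE WEIGHTED SECTION ON EACH TWO-EDGE-DELETED GROUND SET.** For a
`π`-stable `S`, a block `H`, a cut `t₀+6`, a base level `c₀ < t₀+2` with `Shell_S(t₀+6,c₀+2) ≠ ∅`, coefficients `u₂,u₁,u₀`,
a point `x`, and the weighted sections `W(S′,y) = E_{S′,t₀+4,c₀}[1_{X=y}(u₂′n_A(n_A−1) + u₁′n_A + u₀)]`,
`u₂′ = u₂(t₀+6−c₀)/(t₀+2−c₀)`, `u₁′ = u₁(t₀+6−c₀)/(t₀+4−c₀)` (`n_A` counted in `S′`), the frozen-coefficient first level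
difference of the three-law form satisfies
`u₂p₂(c₀)[G₂(c₀+2)−G₂(c₀)] + u₁p₁(c₀)[G₁(c₀+2)−G₁(c₀)] + u₀[G₀(c₀+2)−G₀(c₀)]
 = −(1/(|S|(|S|−2)))·[Σ_{p∈vAA}Σ_{q∈vDD} ∇²_x W(S∖e_p∖e_q,·)(x) − Σ_{p∈vBH}Σ_{q∈vBN, q≠πp} ∇²_x W(S∖e_p∖e_q,·)(x)]`
(`levelStep_shellLaw` for each of the three laws, the regrouping `sum_reps_delStep_sdiff_pair_eq`, and the three-law form
on each deleted ground set: the pinning probabilities of `S` and of `S∖e_p∖e_q` differ by the factors `(t₀+6−c₀)/(t₀+4−c₀)`,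
`(t₀+6−c₀)(t₀+4−c₀)/((t₀+4−c₀)(t₀+2−c₀))`). [cite: Rothvoss2017, §2 (PDF p. 6)] [cite: GodsilMeagher2015, §15.2] -/
theorem main_one_eq {S : Finset (Fin n)} (hS : ∀ u ∈ S, π u ∈ S) (H : Finset (Fin n)) {t₀ c₀ : ℕ}
    (hc : c₀ < t₀ + 2) (hne : (shellIn π S (t₀ + 6) (c₀ + 2)).Nonempty) (u₂ u₁ u₀ : ℝ) (x : ℤ)
    (W : Finset (Fin n) → ℤ → ℝ)
    (hW : ∀ S' y, W S' y = (∑ U ∈ ((shellIn π S' (t₀ + 4) c₀).filter fun U => ((U ∩ H).card : ℤ) = y),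
        (u₂ * (((t₀ : ℝ) + 6 - c₀) / ((t₀ : ℝ) + 2 - c₀)) *
            (((((reps π (vAA π S' H)).filter fun v => v ∈ U ∧ π v ∈ U).card : ℕ) : ℝ) *
              (((((reps π (vAA π S' H)).filter fun v => v ∈ U ∧ π v ∈ U).card : ℕ) : ℝ) - 1)) +
          u₁ * (((t₀ : ℝ) + 6 - c₀) / ((t₀ : ℝ) + 4 - c₀)) *
            ((((reps π (vAA π S' H)).filter fun v => v ∈ U ∧ π v ∈ U).card : ℕ) : ℝ) + u₀)) /
        ((shellIn π S' (t₀ + 4) c₀).card : ℝ)) :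
    u₂ * ((((t₀ : ℝ) + 6 - c₀) * ((t₀ : ℝ) + 4 - c₀)) / ((S.card : ℝ) * ((S.card : ℝ) - 2))) *
          ((∑ v ∈ reps π (vAA π S H), ∑ w ∈ (reps π (vAA π S H)).erase v,
              shellLaw π (del2 π S v w) H (t₀ + 2) (c₀ + 2) (x - 4)) -
            ∑ v ∈ reps π (vAA π S H), ∑ w ∈ (reps π (vAA π S H)).erase v,
              shellLaw π (del2 π S v w) H (t₀ + 2) c₀ (x - 4)) +
        u₁ * (((t₀ : ℝ) + 6 - c₀) / (S.card : ℝ)) *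
          ((∑ v ∈ reps π (vAA π S H), shellLaw π (S \ {v, π v}) H (t₀ + 4) (c₀ + 2) (x - 2)) -
            ∑ v ∈ reps π (vAA π S H), shellLaw π (S \ {v, π v}) H (t₀ + 4) c₀ (x - 2)) +
        u₀ * (shellLaw π S H (t₀ + 6) (c₀ + 2) x - shellLaw π S H (t₀ + 6) c₀ x) =
      -(1 / ((S.card : ℝ) * ((S.card : ℝ) - 2))) *
        ((∑ p ∈ vAA π S H, ∑ q ∈ vDD π S H,
            (W (del2 π S p q) x - 2 * W (del2 π S p q) (x - 1) + W (del2 π S p q) (x - 2))) -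
          ∑ p ∈ vBH π S H, ∑ q ∈ (vBN π S H).erase (π p),
            (W (del2 π S p q) x - 2 * W (del2 π S p q) (x - 1) + W (del2 π S p q) (x - 2))) := by
  -- sizes
  obtain ⟨U0, hU0⟩ := hne
  have hSc : t₀ + 6 + (c₀ + 2) ≤ S.card := add_le_of_mem_shellIn hπ hS hU0
  have hne : (shellIn π S (t₀ + 6) (c₀ + 2)).Nonempty := ⟨U0, hU0⟩
  have hS8 : (8 : ℝ) ≤ S.card := by exact_mod_cast (show 8 ≤ S.card by omega)
  have hs0 : (S.card : ℝ) ≠ 0 := by linarith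
  have hs2 : (S.card : ℝ) - 2 ≠ 0 := by linarith
  have hs4 : (S.card : ℝ) - 4 ≠ 0 := by linarith
  have hs6 : (S.card : ℝ) - 6 ≠ 0 := by linarith
  have hT2 : (t₀ : ℝ) + 2 - c₀ ≠ 0 := by
    have : (c₀ : ℝ) < (t₀ : ℝ) + 2 := by exact_mod_cast hc
    linarith
  have hT4 : (t₀ : ℝ) + 4 - c₀ ≠ 0 := by
    have : (c₀ : ℝ) < (t₀ : ℝ) + 2 := by exact_mod_cast hc
    linarith
  have hvS : ∀ v ∈ reps π (vAA π S H), v ∈ S := fun v hv => (mem_vAA.1 (mem_reps.1 hv).1).1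
  have hdiff : ∀ v ∈ reps π (vAA π S H), ∀ w ∈ (reps π (vAA π S H)).erase v, w ≠ v ∧ w ≠ π v := by
    intro v hv w hw
    obtain ⟨hwv, hw'⟩ := mem_erase.1 hw
    refine ⟨hwv, fun h => ?_⟩
    have h1 := (mem_reps.1 hv).2
    have h2 := (mem_reps.1 hw').2
    rw [h, hπ] at h2
    exact lt_asymm h1 h2
  -- nonemptiness of the pinned shells
  have hne_v : ∀ v ∈ reps π (vAA π S H), (shellIn π (S \ {v, π v}) (t₀ + 4) (c₀ + 2)).Nonempty :=
    fun v hv => shellIn_sdiff_pair_nonempty_of_full hπ hπ' hS (hvS v hv) (t := t₀ + 4) hne (by omega)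
  have hne_vw : ∀ v ∈ reps π (vAA π S H), ∀ w ∈ (reps π (vAA π S H)).erase v,
      (shellIn π (del2 π S v w) (t₀ + 2) (c₀ + 2)).Nonempty := by
    intro v hv w hw
    have hw' : w ∈ S \ {v, π v} := by
      rw [mem_sdiff, mem_insert, mem_singleton, not_or]
      exact ⟨hvS w (mem_erase.1 hw).2, (hdiff v hv w hw).1, (hdiff v hv w hw).2⟩
    rw [del2_eq_sdiff_sdiff]
    exact shellIn_sdiff_pair_nonempty_of_full hπ hπ' (sdiff_pair_stable hπ hS v) hw' (t := t₀ + 2) (hne_v v hv)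
      (by omega)
  -- (C0) the level step of the law on `S`
  have h0 : shellLaw π S H (t₀ + 6) (c₀ + 2) x - shellLaw π S H (t₀ + 6) c₀ x =
      -(1 / ((S.card : ℝ) * ((S.card : ℝ) - 2))) * (delStepLaw π S H (t₀ + 4) c₀ x -
        2 * delStepLaw π S H (t₀ + 4) c₀ (x - 1) + delStepLaw π S H (t₀ + 4) c₀ (x - 2)) :=
    levelStep_shellLaw hπ hπ' hS H (t₀ + 4) c₀ hne x
  -- (C1) the level steps of the one-edge-deleted laws, regrouped
  obtain ⟨R1, hR1⟩ : ∃ R1 : ℤ → ℝ, ∀ y, R1 y =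
      (∑ p ∈ vAA π S H, ∑ q ∈ vDD π S H, ∑ v ∈ reps π (vAA π (del2 π S p q) H),
          shellLaw π (del2 π S p q \ {v, π v}) H (t₀ + 2) c₀ y) -
        ∑ p ∈ vBH π S H, ∑ q ∈ (vBN π S H).erase (π p), ∑ v ∈ reps π (vAA π (del2 π S p q) H),
          shellLaw π (del2 π S p q \ {v, π v}) H (t₀ + 2) c₀ y := ⟨_, fun _ => rfl⟩
  have hR1' : ∀ y, ∑ v ∈ reps π (vAA π S H), delStepLaw π (S \ {v, π v}) H (t₀ + 2) c₀ y = R1 y := by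
    intro y; rw [hR1, sum_reps_delStepLaw_sdiff_pair_eq hπ S H (t₀ + 2) c₀ y]
  have h1 : (∑ v ∈ reps π (vAA π S H), shellLaw π (S \ {v, π v}) H (t₀ + 4) (c₀ + 2) (x - 2)) -
      ∑ v ∈ reps π (vAA π S H), shellLaw π (S \ {v, π v}) H (t₀ + 4) c₀ (x - 2) =
      -(1 / (((S.card : ℝ) - 2) * ((S.card : ℝ) - 4))) * (R1 (x - 2) - 2 * R1 (x - 2 - 1) + R1 (x - 2 - 2)) := by
    rw [← sum_sub_distrib]
    have hstep : ∀ v ∈ reps π (vAA π S H),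
        shellLaw π (S \ {v, π v}) H (t₀ + 4) (c₀ + 2) (x - 2) - shellLaw π (S \ {v, π v}) H (t₀ + 4) c₀ (x - 2) =
          -(1 / (((S.card : ℝ) - 2) * ((S.card : ℝ) - 4))) * (delStepLaw π (S \ {v, π v}) H (t₀ + 2) c₀ (x - 2) -
            2 * delStepLaw π (S \ {v, π v}) H (t₀ + 2) c₀ (x - 2 - 1) +
            delStepLaw π (S \ {v, π v}) H (t₀ + 2) c₀ (x - 2 - 2)) := by
      intro v hv
      have h := levelStep_shellLaw hπ hπ' (sdiff_pair_stable hπ hS v) H (t₀ + 2) c₀ (hne_v v hv) (x - 2)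
      have hcv : (((S \ {v, π v}).card : ℕ) : ℝ) = (S.card : ℝ) - 2 := by
        have := card_sdiff_pair hπ' hS (hvS v hv)
        have : (((S \ {v, π v}).card : ℕ) : ℝ) + 2 = S.card := by exact_mod_cast this
        linarith
      rw [hcv, show (S.card : ℝ) - 2 - 2 = (S.card : ℝ) - 4 by ring] at h
      exact h
    rw [sum_congr rfl hstep, sum_mul_nab2, hR1', hR1', hR1']
  -- (C2) the level steps of the two-edge-deleted laws, regrouped twice
  obtain ⟨R2, hR2⟩ : ∃ R2 : ℤ → ℝ, ∀ y, R2 y =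
      (∑ p ∈ vAA π S H, ∑ q ∈ vDD π S H, ∑ v ∈ reps π (vAA π (del2 π S p q) H),
          ∑ w ∈ (reps π (vAA π (del2 π S p q) H)).erase v, shellLaw π (del2 π (del2 π S p q) v w) H t₀ c₀ y) -
        ∑ p ∈ vBH π S H, ∑ q ∈ (vBN π S H).erase (π p), ∑ v ∈ reps π (vAA π (del2 π S p q) H),
          ∑ w ∈ (reps π (vAA π (del2 π S p q) H)).erase v, shellLaw π (del2 π (del2 π S p q) v w) H t₀ c₀ y :=
    ⟨_, fun _ => rfl⟩
  have hR2' : ∀ y, ∑ v ∈ reps π (vAA π S H), ∑ w ∈ (reps π (vAA π S H)).erase v,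
      delStepLaw π (del2 π S v w) H t₀ c₀ y = R2 y := by
    intro y; rw [hR2, sum_reps_reps_delStepLaw_del2_eq hπ S H t₀ c₀ y]
  have h2 : (∑ v ∈ reps π (vAA π S H), ∑ w ∈ (reps π (vAA π S H)).erase v,
        shellLaw π (del2 π S v w) H (t₀ + 2) (c₀ + 2) (x - 4)) -
      ∑ v ∈ reps π (vAA π S H), ∑ w ∈ (reps π (vAA π S H)).erase v,
        shellLaw π (del2 π S v w) H (t₀ + 2) c₀ (x - 4) =
      -(1 / (((S.card : ℝ) - 4) * ((S.card : ℝ) - 6))) * (R2 (x - 4) - 2 * R2 (x - 4 - 1) + R2 (x - 4 - 2)) := by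
    rw [← sum_sub_distrib]
    have hstep : ∀ v ∈ reps π (vAA π S H),
        (∑ w ∈ (reps π (vAA π S H)).erase v, shellLaw π (del2 π S v w) H (t₀ + 2) (c₀ + 2) (x - 4)) -
          ∑ w ∈ (reps π (vAA π S H)).erase v, shellLaw π (del2 π S v w) H (t₀ + 2) c₀ (x - 4) =
        ∑ w ∈ (reps π (vAA π S H)).erase v, (-(1 / (((S.card : ℝ) - 4) * ((S.card : ℝ) - 6))) *
          (delStepLaw π (del2 π S v w) H t₀ c₀ (x - 4) - 2 * delStepLaw π (del2 π S v w) H t₀ c₀ (x - 4 - 1) +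
            delStepLaw π (del2 π S v w) H t₀ c₀ (x - 4 - 2))) := by
      intro v hv
      rw [← sum_sub_distrib]
      refine sum_congr rfl fun w hw => ?_
      have h := levelStep_shellLaw hπ hπ' (del2_stable hπ hS v w) H t₀ c₀ (hne_vw v hv w hw) (x - 4)
      have hcvw : ((del2 π S v w).card : ℝ) = (S.card : ℝ) - 4 :=
        card_del2 hπ hπ' hS (hvS v hv) (hvS w (mem_erase.1 hw).2) (hdiff v hv w hw).1 (hdiff v hv w hw).2
      rw [hcvw, show (S.card : ℝ) - 4 - 2 = (S.card : ℝ) - 6 by ring] at h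
      exact h
    rw [sum_congr rfl hstep, sum_sum_mul_nab2, hR2', hR2', hR2']
  -- (CW) the weighted sections on the deleted ground sets in three-law form, summed over the pairs
  have hWpq : ∀ p q : Fin n, p ∈ S → q ∈ S → q ≠ p → q ≠ π p → ∀ y, W (del2 π S p q) y =
      (u₂ * (((t₀ : ℝ) + 6 - c₀) / ((t₀ : ℝ) + 2 - c₀))) *
          ((((t₀ : ℝ) + 4 - c₀) * ((t₀ : ℝ) + 2 - c₀)) / (((S.card : ℝ) - 4) * ((S.card : ℝ) - 6))) *
          ∑ v ∈ reps π (vAA π (del2 π S p q) H), ∑ w ∈ (reps π (vAA π (del2 π S p q) H)).erase v,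
            shellLaw π (del2 π (del2 π S p q) v w) H t₀ c₀ (y - 4) +
        (u₁ * (((t₀ : ℝ) + 6 - c₀) / ((t₀ : ℝ) + 4 - c₀))) * (((t₀ : ℝ) + 4 - c₀) / ((S.card : ℝ) - 4)) *
          ∑ v ∈ reps π (vAA π (del2 π S p q) H), shellLaw π (del2 π S p q \ {v, π v}) H (t₀ + 2) c₀ (y - 2) +
        u₀ * shellLaw π (del2 π S p q) H (t₀ + 4) c₀ y := by
    intro p q hp hq hqp hqπ y
    have hnepq : (shellIn π (del2 π S p q) (t₀ + 4) c₀).Nonempty :=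
      shellIn_del2_nonempty hπ hπ' hS (t := t₀ + 4) (c := c₀) hne hp hq hqp hqπ
    rw [hW, weightedSection_eq_laws hπ hπ' (del2_stable hπ hS p q) H hnepq _ _ u₀ y, card_del2 hπ hπ' hS hp hq hqp hqπ,
      show (S.card : ℝ) - 4 - 2 = (S.card : ℝ) - 6 by ring]
  have hCW : ∀ y, (∑ p ∈ vAA π S H, ∑ q ∈ vDD π S H, W (del2 π S p q) y) -
      ∑ p ∈ vBH π S H, ∑ q ∈ (vBN π S H).erase (π p), W (del2 π S p q) y =
      (u₂ * (((t₀ : ℝ) + 6 - c₀) / ((t₀ : ℝ) + 2 - c₀))) *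
          ((((t₀ : ℝ) + 4 - c₀) * ((t₀ : ℝ) + 2 - c₀)) / (((S.card : ℝ) - 4) * ((S.card : ℝ) - 6))) * R2 (y - 4) +
        (u₁ * (((t₀ : ℝ) + 6 - c₀) / ((t₀ : ℝ) + 4 - c₀))) * (((t₀ : ℝ) + 4 - c₀) / ((S.card : ℝ) - 4)) * R1 (y - 2) +
        u₀ * delStepLaw π S H (t₀ + 4) c₀ y := by
    intro y
    have eA : ∀ p ∈ vAA π S H, ∀ q ∈ vDD π S H, p ∈ S ∧ q ∈ S ∧ q ≠ p ∧ q ≠ π p := by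
      intro p hp q hq
      obtain ⟨hpS, hpH, hπpH⟩ := mem_vAA.1 hp
      obtain ⟨hqS, hqH, -⟩ := mem_vDD.1 hq
      exact ⟨hpS, hqS, fun e => hqH (by rw [e]; exact hpH), fun e => hqH (by rw [e]; exact hπpH)⟩
    have eB : ∀ p ∈ vBH π S H, ∀ q ∈ (vBN π S H).erase (π p), p ∈ S ∧ q ∈ S ∧ q ≠ p ∧ q ≠ π p := by
      intro p hp q hq
      obtain ⟨hpS, hpH, -⟩ := mem_vBH.1 hp
      obtain ⟨hqπp, hq'⟩ := mem_erase.1 hq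
      obtain ⟨hqS, hqH, -⟩ := mem_vBN.1 hq'
      exact ⟨hpS, hqS, fun e => hqH (by rw [e]; exact hpH), hqπp⟩
    rw [sum_congr rfl fun p hp => sum_congr rfl fun q hq => hWpq p q (eA p hp q hq).1 (eA p hp q hq).2.1
        (eA p hp q hq).2.2.1 (eA p hp q hq).2.2.2 y,
      sum_congr rfl fun p hp => sum_congr rfl fun q hq => hWpq p q (eB p hp q hq).1 (eB p hp q hq).2.1
        (eB p hp q hq).2.2.1 (eB p hp q hq).2.2.2 y, signedPairSum_three, ← hR2, ← hR1]
    unfold delStepLaw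
    rfl
  -- assemble
  rw [h2, h1, h0, signedPairSum_nab2 (vAA π S H) (fun _ => vDD π S H) (vBH π S H) (fun p => (vBN π S H).erase (π p))
    (fun p q y => W (del2 π S p q) y) x]
  rw [hCW x, hCW (x - 1), hCW (x - 2), sub_right_comm x 1 4, sub_right_comm x 2 4, sub_right_comm x 1 2]
  field_simp
  ring

/-- **The drift of the first level step** is a combination of the factorial-moment sections of `S` ITSELF at the next
level: with `Δp₂ = −4(t₀+4−c₀)/(|S|(|S|−2))`, `Δp₁ = −2/|S|` (cut `t₀+6`, base level `c₀`),
`u₂·Δp₂·G₂(c₀+2) + u₁·Δp₁·G₁(c₀+2) = E_{S,t₀+6,c₀+2}[1_{X=x}(−(4u₂/(t₀+2−c₀))·n_A(n_A−1) − (2u₁/(t₀+4−c₀))·n_A)]`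
(the pinning probabilities at level `c₀+2` are `p₂(c₀+2) = (t₀+4−c₀)(t₀+2−c₀)/(|S|(|S|−2))`, `p₁(c₀+2) = (t₀+4−c₀)/|S|`).
[cite: Rothvoss2017, §2 (PDF p. 6)] [cite: GodsilMeagher2015, §15.2] -/
theorem drift_one_eq {S : Finset (Fin n)} (hS : ∀ u ∈ S, π u ∈ S) (H : Finset (Fin n)) {t₀ c₀ : ℕ}
    (hc : c₀ < t₀ + 2) (hne : (shellIn π S (t₀ + 6) (c₀ + 2)).Nonempty) (u₂ u₁ : ℝ) (x : ℤ) :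
    u₂ * (-(4 * ((t₀ : ℝ) + 4 - c₀)) / ((S.card : ℝ) * ((S.card : ℝ) - 2))) *
          ∑ v ∈ reps π (vAA π S H), ∑ w ∈ (reps π (vAA π S H)).erase v,
            shellLaw π (del2 π S v w) H (t₀ + 2) (c₀ + 2) (x - 4) +
        u₁ * (-2 / (S.card : ℝ)) * ∑ v ∈ reps π (vAA π S H), shellLaw π (S \ {v, π v}) H (t₀ + 4) (c₀ + 2) (x - 2) =
      (∑ U ∈ ((shellIn π S (t₀ + 6) (c₀ + 2)).filter fun U => ((U ∩ H).card : ℤ) = x),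
          (-(4 * u₂ / ((t₀ : ℝ) + 2 - c₀)) *
              (((((reps π (vAA π S H)).filter fun v => v ∈ U ∧ π v ∈ U).card : ℕ) : ℝ) *
                (((((reps π (vAA π S H)).filter fun v => v ∈ U ∧ π v ∈ U).card : ℕ) : ℝ) - 1)) +
            -(2 * u₁ / ((t₀ : ℝ) + 4 - c₀)) *
              ((((reps π (vAA π S H)).filter fun v => v ∈ U ∧ π v ∈ U).card : ℕ) : ℝ) + 0)) /
        ((shellIn π S (t₀ + 6) (c₀ + 2)).card : ℝ) := by
  obtain ⟨U0, hU0⟩ := hne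
  have hSc : t₀ + 6 + (c₀ + 2) ≤ S.card := add_le_of_mem_shellIn hπ hS hU0
  have hS8 : (8 : ℝ) ≤ S.card := by exact_mod_cast (show 8 ≤ S.card by omega)
  have hs0 : (S.card : ℝ) ≠ 0 := by linarith
  have hs2 : (S.card : ℝ) - 2 ≠ 0 := by linarith
  have hclt : (c₀ : ℝ) < (t₀ : ℝ) + 2 := by exact_mod_cast hc
  have hT2 : (t₀ : ℝ) + 2 - c₀ ≠ 0 := by linarith
  have hT4 : (t₀ : ℝ) + 4 - c₀ ≠ 0 := by linarith
  have hne' : (shellIn π S (t₀ + 2 + 4) (c₀ + 2)).Nonempty := ⟨U0, hU0⟩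
  rw [weightedSection_eq_laws hπ hπ' hS H hne' _ _ 0 x]
  push_cast
  field_simp
  ring

omit hπ hπ' in
/-- The centred square as a quadratic weight: `(n_A − m)² = n_A(n_A−1) + (1−2m)n_A + m²` inside a section.
[cite: Rothvoss2017, §2 (PDF p. 6)] -/
theorem centredSq_section_eq (S H : Finset (Fin n)) (t c : ℕ) (x : ℤ) (m : ℝ) :
    (∑ U ∈ ((shellIn π S t c).filter fun U => ((U ∩ H).card : ℤ) = x),
        (((((reps π (vAA π S H)).filter fun v => v ∈ U ∧ π v ∈ U).card : ℕ) : ℝ) - m) ^ 2) /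
        ((shellIn π S t c).card : ℝ) =
      (∑ U ∈ ((shellIn π S t c).filter fun U => ((U ∩ H).card : ℤ) = x),
        (1 * (((((reps π (vAA π S H)).filter fun v => v ∈ U ∧ π v ∈ U).card : ℕ) : ℝ) *
            (((((reps π (vAA π S H)).filter fun v => v ∈ U ∧ π v ∈ U).card : ℕ) : ℝ) - 1)) +
          (1 - 2 * m) * ((((reps π (vAA π S H)).filter fun v => v ∈ U ∧ π v ∈ U).card : ℕ) : ℝ) + m ^ 2)) /
        ((shellIn π S t c).card : ℝ) := by
  congr 1
  exact sum_congr rfl fun U _ => by ring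

omit hπ hπ' in
/-- The centred first power as a weight: `n_A − m = 0·n_A(n_A−1) + 1·n_A + (−m)` inside a section.
[cite: Rothvoss2017, §2 (PDF p. 6)] -/
theorem centred_section_eq (S H : Finset (Fin n)) (t c : ℕ) (x : ℤ) (m : ℝ) :
    (∑ U ∈ ((shellIn π S t c).filter fun U => ((U ∩ H).card : ℤ) = x),
        (((((reps π (vAA π S H)).filter fun v => v ∈ U ∧ π v ∈ U).card : ℕ) : ℝ) - m)) /
        ((shellIn π S t c).card : ℝ) =
      (∑ U ∈ ((shellIn π S t c).filter fun U => ((U ∩ H).card : ℤ) = x),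
        (0 * (((((reps π (vAA π S H)).filter fun v => v ∈ U ∧ π v ∈ U).card : ℕ) : ℝ) *
            (((((reps π (vAA π S H)).filter fun v => v ∈ U ∧ π v ∈ U).card : ℕ) : ℝ) - 1)) +
          1 * ((((reps π (vAA π S H)).filter fun v => v ∈ U ∧ π v ∈ U).card : ℕ) : ℝ) + -m)) /
        ((shellIn π S t c).card : ℝ) := by
  congr 1
  exact sum_congr rfl fun U _ => by ring

/-- **THE FIRST LEVEL STEP OF THE CENTRED SECOND MOMENT** `A^m_c(x) = E_{S,t₀+6,c}[1_{X=x}(n_A − m)²]` (any real centring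
`m`): for a `π`-stable `S`, a block `H`, a base level `c₀ < t₀+2` with `Shell_S(t₀+6,c₀+2) ≠ ∅`, and the tilted weighted sections
`W(S′,y) = E_{S′,t₀+4,c₀}[1_{X=y}(((t₀+6−c₀)/(t₀+2−c₀))·n_A(n_A−1) + ((1−2m)(t₀+6−c₀)/(t₀+4−c₀))·n_A + m²)]`,
`A^m_{c₀+2}(x) − A^m_{c₀}(x) = −(1/(|S|(|S|−2)))·[Σ_{p∈vAA}Σ_{q∈vDD} ∇²_xW(S∖e_p∖e_q,·)(x) − Σ_{p∈vBH}Σ_{q∈vBN,q≠πp} ∇²_xW(S∖e_p∖e_q,·)(x)]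
  − (4/(t₀+2−c₀))·A^m_{c₀+2}(x) − (2m−1)·(2(t₀+6−c₀)/((t₀+4−c₀)(t₀+2−c₀)))·B^m_{c₀+2}(x)
  − (2m(4m+c₀−t₀−6)/((t₀+4−c₀)(t₀+2−c₀)))·law_S(t₀+6,c₀+2;x)`,
`B^m_c(x) = E_{S,t₀+6,c}[1_{X=x}(n_A − m)]`: MAIN₁ (`main_one_eq`) plus the drift written through the centred sections at the
next level. The cell uses it at `c₀ = 1` with `m = E_1[n_A | X = x]`, where `B^m_3 = Δ_cB^m(1)`. [cite: Rothvoss2017, §2 (PDF p. 6)]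
[cite: GodsilMeagher2015, §15.2] -/
theorem levelStep_centredSecond_eq {S : Finset (Fin n)} (hS : ∀ u ∈ S, π u ∈ S) (H : Finset (Fin n)) {t₀ c₀ : ℕ}
    (hc : c₀ < t₀ + 2) (hne : (shellIn π S (t₀ + 6) (c₀ + 2)).Nonempty) (m : ℝ) (x : ℤ)
    (W : Finset (Fin n) → ℤ → ℝ)
    (hW : ∀ S' y, W S' y = (∑ U ∈ ((shellIn π S' (t₀ + 4) c₀).filter fun U => ((U ∩ H).card : ℤ) = y),
        (1 * (((t₀ : ℝ) + 6 - c₀) / ((t₀ : ℝ) + 2 - c₀)) *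
            (((((reps π (vAA π S' H)).filter fun v => v ∈ U ∧ π v ∈ U).card : ℕ) : ℝ) *
              (((((reps π (vAA π S' H)).filter fun v => v ∈ U ∧ π v ∈ U).card : ℕ) : ℝ) - 1)) +
          (1 - 2 * m) * (((t₀ : ℝ) + 6 - c₀) / ((t₀ : ℝ) + 4 - c₀)) *
            ((((reps π (vAA π S' H)).filter fun v => v ∈ U ∧ π v ∈ U).card : ℕ) : ℝ) + m ^ 2)) /
        ((shellIn π S' (t₀ + 4) c₀).card : ℝ)) :
    (∑ U ∈ ((shellIn π S (t₀ + 6) (c₀ + 2)).filter fun U => ((U ∩ H).card : ℤ) = x),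
          (((((reps π (vAA π S H)).filter fun v => v ∈ U ∧ π v ∈ U).card : ℕ) : ℝ) - m) ^ 2) /
          ((shellIn π S (t₀ + 6) (c₀ + 2)).card : ℝ) -
        (∑ U ∈ ((shellIn π S (t₀ + 6) c₀).filter fun U => ((U ∩ H).card : ℤ) = x),
          (((((reps π (vAA π S H)).filter fun v => v ∈ U ∧ π v ∈ U).card : ℕ) : ℝ) - m) ^ 2) /
          ((shellIn π S (t₀ + 6) c₀).card : ℝ) =
      -(1 / ((S.card : ℝ) * ((S.card : ℝ) - 2))) *
          ((∑ p ∈ vAA π S H, ∑ q ∈ vDD π S H,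
              (W (del2 π S p q) x - 2 * W (del2 π S p q) (x - 1) + W (del2 π S p q) (x - 2))) -
            ∑ p ∈ vBH π S H, ∑ q ∈ (vBN π S H).erase (π p),
              (W (del2 π S p q) x - 2 * W (del2 π S p q) (x - 1) + W (del2 π S p q) (x - 2))) -
        (4 / ((t₀ : ℝ) + 2 - c₀)) *
          ((∑ U ∈ ((shellIn π S (t₀ + 6) (c₀ + 2)).filter fun U => ((U ∩ H).card : ℤ) = x),
            (((((reps π (vAA π S H)).filter fun v => v ∈ U ∧ π v ∈ U).card : ℕ) : ℝ) - m) ^ 2) /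
            ((shellIn π S (t₀ + 6) (c₀ + 2)).card : ℝ)) -
        (2 * m - 1) * (2 * ((t₀ : ℝ) + 6 - c₀) / (((t₀ : ℝ) + 4 - c₀) * ((t₀ : ℝ) + 2 - c₀))) *
          ((∑ U ∈ ((shellIn π S (t₀ + 6) (c₀ + 2)).filter fun U => ((U ∩ H).card : ℤ) = x),
            (((((reps π (vAA π S H)).filter fun v => v ∈ U ∧ π v ∈ U).card : ℕ) : ℝ) - m)) /
            ((shellIn π S (t₀ + 6) (c₀ + 2)).card : ℝ)) -
        (2 * m * (4 * m + c₀ - t₀ - 6) / (((t₀ : ℝ) + 4 - c₀) * ((t₀ : ℝ) + 2 - c₀))) *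
          shellLaw π S H (t₀ + 6) (c₀ + 2) x := by
  obtain ⟨U0, hU0⟩ := hne
  have hSc : t₀ + 6 + (c₀ + 2) ≤ S.card := add_le_of_mem_shellIn hπ hS hU0
  have hne : (shellIn π S (t₀ + 6) (c₀ + 2)).Nonempty := ⟨U0, hU0⟩
  have hS8 : (8 : ℝ) ≤ S.card := by exact_mod_cast (show 8 ≤ S.card by omega)
  have hs0 : (S.card : ℝ) ≠ 0 := by linarith
  have hs2 : (S.card : ℝ) - 2 ≠ 0 := by linarith
  have hclt : (c₀ : ℝ) < (t₀ : ℝ) + 2 := by exact_mod_cast hc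
  have hT2 : (t₀ : ℝ) + 2 - c₀ ≠ 0 := by linarith
  have hT4 : (t₀ : ℝ) + 4 - c₀ ≠ 0 := by linarith
  -- the three-law forms of `A^m` at both levels and of `B^m` at the upper level
  have hne1 : (shellIn π S (t₀ + 2 + 4) (c₀ + 2)).Nonempty := hne
  have hne0 : (shellIn π S (t₀ + 2 + 4) c₀).Nonempty := shellIn_nonempty_down hπ hπ' hS hne
  have hA1 := weightedSection_eq_laws hπ hπ' hS H hne1 1 (1 - 2 * m) (m ^ 2) x
  have hA0 := weightedSection_eq_laws hπ hπ' hS H hne0 1 (1 - 2 * m) (m ^ 2) x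
  have hB1 := weightedSection_eq_laws hπ hπ' hS H hne1 0 1 (-m) x
  have hM := main_one_eq hπ hπ' hS H hc hne 1 (1 - 2 * m) (m ^ 2) x W hW
  rw [centredSq_section_eq, centredSq_section_eq, centred_section_eq, hA1, hA0, hB1, ← hM]
  push_cast
  field_simp
  ring

end StepOne

end ShellStep

end Literature.Combinatorics.Optimization

end
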